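import Literature.Topology.FourManifolds.ZeroSphereSurgeryNonorientable
import Literature.Topology.FourManifolds.ModelSweepTwist
import Literature.Topology.FourManifolds.MilnorLocalEmbeddingGlobalization
import Mathlib.Geometry.Euclidean.Inversion.Calculus
import Mathlib.Analysis.InnerProductSpace.Projection.FiniteDimensional
import HarnessLib

/-!
# The Jacobian signs of the two standard framing discs of a `0`-surgery

Topic `Literature/Topology/FourManifolds`.  The two standard framing discs `discNear`, `discFar`
of the local model of the `0`-surgery along a framed `S⁰` (`ZeroSphereSurgeryModelGluing.lean`,
§9: `D₊ = β̂⁻¹ ∘ N ∘ (x ↦ x/4)`, `D₋ = β̂⁻¹ ∘ N ∘ inv₈` on the unit ball, `N` the Möbius inversion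
centred at `q`, `inv₈ w = 8 w/‖w‖²`, `β̂⁻¹` the radial blow-down) have OPPOSITE Jacobian signs on
the open unit ball: `det d(D₊) < 0` (one inversion) and `det d(D₋) > 0` (two inversions) —
`det_fderiv_discNear_neg`, `det_fderiv_discFar_pos`.  This is the orientation datum of the model
(A. A. Kosinski, *Differential Manifolds* (1993), VI (6.6): the feet of an orientable `1`-handle
are oppositely oriented; in Milnor's `S³ = ℝ³ ∪ ∞` picture the ball at `∞` is parametrised
through the inversion), consumed by the orientability obstruction
`ZeroSphereOrientation.not_smoothOrientation_of_reflected_foot` in the discharge of HALF B of the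
one-handle step (`OneHandleBoundaryStepProofs.lean`).  Ingredients: an inversion has negative
Jacobian determinant (Mathlib's `EuclideanGeometry.hasFDerivAt_inversion`: a positive multiple of a
hyperplane reflection, `det_reflection_orthogonal_singleton` of `ModelSweepTwist.lean`; for `N`
this is `det_fderiv_mobN_neg` of `ZeroSphereSurgeryNonorientable.lean`); the blow-down `β̂⁻¹` has
positive Jacobian (it is `8⁻¹ • id` near `0`, its Jacobian never vanishes, intermediate value
theorem on the connected `ℝ³`, the tree's `det_fderiv_pos_of_injective`).  Companion of `ZeroSphereSurgeryNonorientable.lean` (which computes the same signs inside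
one proof): here the two signs are recorded as standalone lemmas on the whole (punctured) unit
ball.  Everything here is proved; no named facts are introduced.

## References

* A. A. Kosinski, *Differential Manifolds* (1993), VI (6.6), VI §9. [Kosinski1993]
-/

open scoped Manifold ContDiff Topology
open Set Function Metric Module

noncomputable section

namespace Literature.Topology.FourManifolds

namespace ZeroSphereModel

/-- Local notation: `𝔼3` is `EuclideanSpace ℝ (Fin 3)`. -/
local notation "𝔼3" => EuclideanSpace ℝ (Fin 3)

/-- Shorthand for the Jacobian determinant of `f : ℝ³ → ℝ³` at `x`. [folklore] -/
abbrev jacDet (f : 𝔼3 → 𝔼3) (x : 𝔼3) : ℝ :=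
  LinearMap.det ((fderiv ℝ f x : 𝔼3 →L[ℝ] 𝔼3) : 𝔼3 →ₗ[ℝ] 𝔼3)

/-- Chain rule for the Jacobian determinant. [folklore] -/
theorem jacDet_comp {f g : 𝔼3 → 𝔼3} {x : 𝔼3} (hf : DifferentiableAt ℝ f (g x))
    (hg : DifferentiableAt ℝ g x) : jacDet (f ∘ g) x = jacDet f (g x) * jacDet g x := by
  rw [jacDet, fderiv_comp x hf hg]
  exact LinearMap.det_comp _ _

/-- The Jacobian determinant only depends on the germ. [folklore] -/
theorem jacDet_congr {f g : 𝔼3 → 𝔼3} {x : 𝔼3} (h : f =ᶠ[𝓝 x] g) : jacDet f x = jacDet g x := by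
  rw [jacDet, h.fderiv_eq]

/-! ### Inversions reverse orientation -/

/-- **An inversion of `ℝ³` has negative Jacobian determinant** off its centre: its derivative is
a positive multiple of a hyperplane reflection (`EuclideanGeometry.hasFDerivAt_inversion`).
[folklore] -/
theorem det_fderiv_inversion_neg {c x : 𝔼3} {R : ℝ} (hR : R ≠ 0) (hx : x ≠ c) :
    jacDet (EuclideanGeometry.inversion c R) x < 0 := by
  rw [jacDet, (EuclideanGeometry.hasFDerivAt_inversion (R := R) hx).fderiv]
  have hd : 0 < dist x c := dist_pos.2 hx
  have hn : 0 < (R / dist x c) ^ 2 := by positivity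
  rw [ContinuousLinearMap.toLinearMap_smul, LinearMap.det_smul]
  have e : ((((ℝ ∙ (x - c))ᗮ.reflection : 𝔼3 →L[ℝ] 𝔼3) : 𝔼3 →ₗ[ℝ] 𝔼3)) =
      ((ℝ ∙ (x - c))ᗮ.reflection.toLinearEquiv : 𝔼3 →ₗ[ℝ] 𝔼3) := rfl
  rw [show Module.finrank ℝ 𝔼3 = 3 from finrank_euclideanSpace_fin, e,
    det_reflection_orthogonal_singleton (sub_ne_zero.2 hx)]
  have : 0 < ((R / dist x c) ^ 2) ^ 3 := by positivity
  linarith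

/-- **The inversion `inv₈ w = 8 w/‖w‖²` is the inversion of centre `0` and radius `√8`.**
[folklore] -/
theorem inv8_eq_inversion (w : 𝔼3) :
    (8 / ‖w‖ ^ 2) • w = EuclideanGeometry.inversion (0 : 𝔼3) (Real.sqrt 8) w := by
  rw [EuclideanGeometry.inversion, dist_zero_right, vsub_eq_sub, sub_zero, vadd_eq_add, add_zero,
    div_pow, Real.sq_sqrt (by norm_num)]

/-- `det d(inv₈) < 0` off `0`. [folklore] -/
theorem det_fderiv_inv8_neg {w : 𝔼3} (hw : w ≠ 0) :
    jacDet (fun w : 𝔼3 => (8 / ‖w‖ ^ 2) • w) w < 0 := by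
  have h : (fun w : 𝔼3 => (8 / ‖w‖ ^ 2) • w) = EuclideanGeometry.inversion (0 : 𝔼3) (Real.sqrt 8) :=
    funext inv8_eq_inversion
  rw [h]
  exact det_fderiv_inversion_neg (Real.sqrt_ne_zero'.2 (by norm_num)) hw

/-! ### The blow-down preserves orientation -/

/-- **Constant sign of a non-vanishing Jacobian on `ℝ³`** (the tree's
`det_fderiv_pos_of_injective`, `MilnorLocalEmbeddingGlobalization.lean`, in `jacDet` spelling): if
`Ψ` is smooth with everywhere injective derivative and `det dΨ(0) > 0`, then `det dΨ > 0`
everywhere. [folklore] -/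
theorem jacDet_pos_of_injective {Ψ : 𝔼3 → 𝔼3} (hΨ : ContDiff ℝ ∞ Ψ)
    (hD : ∀ x, Injective (fderiv ℝ Ψ x)) (h0 : 0 < jacDet Ψ 0) (x : 𝔼3) : 0 < jacDet Ψ x :=
  det_fderiv_pos_of_injective hΨ hD h0 x

/-- The derivative of the blow-down at the origin is `8⁻¹ • id` (it is `8⁻¹ • id` on the ball of
radius `1/4`, `blowDown_eq_smul_of_norm_lt`). [folklore] -/
theorem hasFDerivAt_blowDown_zero :
    HasFDerivAt blowDown ((8 : ℝ)⁻¹ • ContinuousLinearMap.id ℝ 𝔼3) 0 := by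
  have h1 : HasFDerivAt (fun z : 𝔼3 => (8 : ℝ)⁻¹ • z) ((8 : ℝ)⁻¹ • ContinuousLinearMap.id ℝ 𝔼3) 0 := by
    have := (hasFDerivAt_id (𝕜 := ℝ) (0 : 𝔼3)).const_smul (8 : ℝ)⁻¹
    simpa only [Pi.smul_def, id] using this
  refine h1.congr_of_eventuallyEq ?_
  filter_upwards [Metric.ball_mem_nhds (0 : 𝔼3) (by norm_num : (0 : ℝ) < 1 / 4)] with z hz
  exact blowDown_eq_smul_of_norm_lt (mem_ball_zero_iff.1 hz)

/-- **`det d(β̂⁻¹) > 0` everywhere.** [folklore] -/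
theorem det_fderiv_blowDown_pos (z : 𝔼3) : 0 < jacDet blowDown z := by
  refine jacDet_pos_of_injective contDiff_blowDown injective_fderiv_blowDown ?_ z
  rw [jacDet, hasFDerivAt_blowDown_zero.fderiv, ContinuousLinearMap.toLinearMap_smul, LinearMap.det_smul,
    show Module.finrank ℝ 𝔼3 = 3 from finrank_euclideanSpace_fin]
  have e : ((ContinuousLinearMap.id ℝ 𝔼3 : 𝔼3 →L[ℝ] 𝔼3) : 𝔼3 →ₗ[ℝ] 𝔼3) = LinearMap.id := rfl
  rw [e, LinearMap.det_id]
  norm_num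

/-! ### The two discs -/

/-- **`det d(farMob) > 0` on the punctured ball of radius `4`**: there `farMob = N ∘ inv₈`, two
inversions. [folklore] -/
theorem det_fderiv_farMob_pos {w : 𝔼3} (hw0 : w ≠ 0) (hw : ‖w‖ < 4) : 0 < jacDet farMob w := by
  have hw' : ‖w‖ < 16 / 3 := by linarith
  have hwn : 0 < ‖w‖ := norm_pos_iff.2 hw0
  set v : 𝔼3 := (8 / ‖w‖ ^ 2) • w with hv
  have hvq : v ≠ qPt := by
    intro h
    have h1 : ‖v‖ = 8 / ‖w‖ := by
      rw [hv, norm_smul, Real.norm_of_nonneg (by positivity)]; field_simp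
    have h2 : 2 < 8 / ‖w‖ := by rw [lt_div_iff₀ hwn]; linarith
    rw [h, norm_qPt] at h1
    linarith
  have hdN : DifferentiableAt ℝ mobN v := (contDiffAt_mobN hvq).differentiableAt (by simp)
  have hdI : DifferentiableAt ℝ (fun w : 𝔼3 => (8 / ‖w‖ ^ 2) • w) w :=
    (contDiffAt_inv8 hw0).differentiableAt (by simp)
  rw [jacDet_congr (farMob_eventuallyEq hw0 hw'),
    show (fun w : 𝔼3 => mobN ((8 / ‖w‖ ^ 2) • w)) = mobN ∘ fun w : 𝔼3 => (8 / ‖w‖ ^ 2) • w from rfl,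
    jacDet_comp (f := mobN) (g := fun w : 𝔼3 => (8 / ‖w‖ ^ 2) • w) (x := w) hdN hdI]
  exact mul_pos_of_neg_of_neg (det_fderiv_mobN_neg hvq) (det_fderiv_inv8_neg hw0)

/-- **The far standard disc preserves orientation**: `det d(discFar) > 0` on the punctured open
unit ball (`discFar = β̂⁻¹ ∘ farMob` there). [cite: Kosinski1993, VI (6.6)] -/
theorem det_fderiv_discFar_pos {w : 𝔼3} (hw0 : 0 < ‖w‖) (hw1 : ‖w‖ < 1) : 0 < jacDet discFar w := by
  have hw : w ≠ 0 := norm_pos_iff.1 hw0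
  have hev : discFar =ᶠ[𝓝 w] blowDown ∘ farMob := by
    filter_upwards [Metric.ball_mem_nhds w (by linarith : (0 : ℝ) < 1 - ‖w‖)] with x hx
    refine discFar_of_norm_le ?_
    have hx' : dist x w < 1 - ‖w‖ := hx
    rw [dist_eq_norm] at hx'
    have := norm_sub_norm_le x w
    linarith
  have hdB : DifferentiableAt ℝ blowDown (farMob w) := contDiff_blowDown.contDiffAt.differentiableAt (by simp)
  have hdF : DifferentiableAt ℝ farMob w := (contDiffAt_farMob (by linarith)).differentiableAt (by simp)
  rw [jacDet_congr hev, jacDet_comp (f := blowDown) (g := farMob) (x := w) hdB hdF]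
  exact mul_pos (det_fderiv_blowDown_pos _) (det_fderiv_farMob_pos hw (by linarith))

/-- **The near standard disc reverses orientation**: `det d(discNear) < 0` on the open unit ball
(`discNear = β̂⁻¹ ∘ N ∘ (x ↦ x/4)` there). [cite: Kosinski1993, VI (6.6)] -/
theorem det_fderiv_discNear_neg {w : 𝔼3} (hw1 : ‖w‖ < 1) : jacDet discNear w < 0 := by
  have hev : discNear =ᶠ[𝓝 w] blowDown ∘ mobN ∘ fun x : 𝔼3 => (4 : ℝ)⁻¹ • x := by
    filter_upwards [Metric.ball_mem_nhds w (by linarith : (0 : ℝ) < 1 - ‖w‖)] with x hx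
    refine discNear_of_norm_le ?_
    have hx' : dist x w < 1 - ‖w‖ := hx
    rw [dist_eq_norm] at hx'
    have := norm_sub_norm_le x w
    linarith
  have hq : (4 : ℝ)⁻¹ • w ≠ qPt := by
    intro h
    have := congrArg norm h
    rw [norm_smul, norm_inv, Real.norm_of_nonneg (by norm_num : (0 : ℝ) ≤ 4), norm_qPt] at this
    linarith [norm_nonneg w]
  have hdS : DifferentiableAt ℝ (fun x : 𝔼3 => (4 : ℝ)⁻¹ • x) w :=
    ((contDiff_const_smul (n := (∞ : WithTop ℕ∞)) (4 : ℝ)⁻¹).differentiable (by simp)) w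
  have hdN : DifferentiableAt ℝ mobN ((4 : ℝ)⁻¹ • w) := (contDiffAt_mobN hq).differentiableAt (by simp)
  have hdB : DifferentiableAt ℝ blowDown (mobN ((4 : ℝ)⁻¹ • w)) :=
    contDiff_blowDown.contDiffAt.differentiableAt (by simp)
  have hS : fderiv ℝ (fun x : 𝔼3 => (4 : ℝ)⁻¹ • x) w = (4 : ℝ)⁻¹ • ContinuousLinearMap.id ℝ 𝔼3 := by
    have := (hasFDerivAt_id (𝕜 := ℝ) w).const_smul (4 : ℝ)⁻¹
    simpa only [Pi.smul_def, id] using this.fderiv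
  have hdet3 : jacDet (fun x : 𝔼3 => (4 : ℝ)⁻¹ • x) w = ((4 : ℝ)⁻¹) ^ 3 := by
    rw [jacDet, hS, ContinuousLinearMap.toLinearMap_smul, LinearMap.det_smul,
      show Module.finrank ℝ 𝔼3 = 3 from finrank_euclideanSpace_fin]
    have e : ((ContinuousLinearMap.id ℝ 𝔼3 : 𝔼3 →L[ℝ] 𝔼3) : 𝔼3 →ₗ[ℝ] 𝔼3) = LinearMap.id := rfl
    rw [e, LinearMap.det_id, mul_one]
  rw [jacDet_congr hev, show blowDown ∘ mobN ∘ (fun x : 𝔼3 => (4 : ℝ)⁻¹ • x) =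
      blowDown ∘ (mobN ∘ fun x : 𝔼3 => (4 : ℝ)⁻¹ • x) from rfl,
    jacDet_comp (f := blowDown) (g := mobN ∘ fun x : 𝔼3 => (4 : ℝ)⁻¹ • x) (x := w) hdB (hdN.comp w hdS),
    jacDet_comp (f := mobN) (g := fun x : 𝔼3 => (4 : ℝ)⁻¹ • x) (x := w) hdN hdS, hdet3]
  have h1 := det_fderiv_blowDown_pos (mobN ((4 : ℝ)⁻¹ • w))
  have h2 := det_fderiv_mobN_neg hq
  have h3 : (0 : ℝ) < ((4 : ℝ)⁻¹) ^ 3 := by positivity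
  exact mul_neg_of_pos_of_neg h1 (mul_neg_of_neg_of_pos h2 h3)

end ZeroSphereModel

end Literature.Topology.FourManifolds

end
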